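import Summits.QuantumFields.YangMills.Theorems.F4SubCurvatureDoorSliceFourierUniqueness
import Literature.Analysis.FunctionSpaces.BochnerRealEven
import Mathlib
import HarnessLib

/-!
# Gaussian–cosine moments of real positive-definite functions are nonnegative
# (def-free analytic heart of conjunct 6 «reflection positivity inside the plane» of the registered stub (1) `stub_sliceInClass`,
# LINE g19-A «transverse slice» on crux ⟨stmt-QuantumFields-23035⟩ `F4SubCurvatureDoor.ShortRootRigidity`)

★ `integral_mul_cosGauss_nonneg_of_realPosDef`: on a finite-dimensional real inner product space `V`, a continuous, even, real
positive-definite `φ : V → ℝ` (`∑ᵢⱼ cᵢcⱼ φ(zᵢ − zⱼ) ≥ 0` for real coefficients) satisfies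

  `0 ≤ ∫ φ(x) · cos⟪a,x⟫ · e^{−‖x‖²/2} dx`  for every `a ∈ V`.

Proof: normalise by `φ 0 + 1` (`|φ| ≤ φ 0`, tree `abs_le_apply_zero_of_realPosDef`), pass to the Hermitian form (tree
`isPositiveDefinite_ofReal_of_realPosDef`), and read the Gaussian–cosine moment as the real part of the Fourier transform of the
Gaussian-damped function at `w = a/2π`, which is nonnegative by the tree theorem
`IsPositiveDefinite.re_fourier_gauss_mul_nonneg` (Bochner 1933 §3: the Gaussian is an autocorrelation, integrated positive definiteness).

THEOREMS ONLY; Mathlib + tree; no `sorry`; standard axioms.  HONEST FRAMING: a folklore positivity lemma serving support stub (1) of a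
freshly filed line (route `F4SubCurvatureDoor`, rung R2d); the heart `stub_planarRigidity` (XL), crux 23035 / 23125 and every summit
statement are untouched; the Yang–Mills mass gap is NOT proved.  Width seat `ym-line-sfw-p2-w3` g36 (cell ym-idea-1, free hands),
`--supports stmt-QuantumFields-23035`. [cite: Bochner1933, §3]
-/

set_option autoImplicit false

noncomputable section

open MeasureTheory Complex Real
open scoped RealInnerProductSpace FourierTransform Topology BigOperators

namespace Summit.QuantumFields.YangMills.Theorems.F4SubCurvatureDoorSliceFourier

open Literature.Analysis.FunctionSpaces (IsPositiveDefinite isPositiveDefinite_ofReal_of_realPosDef abs_le_apply_zero_of_realPosDef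
  apply_zero_nonneg_of_realPosDef)

variable {V : Type*} [NormedAddCommGroup V] [InnerProductSpace ℝ V] [FiniteDimensional ℝ V] [MeasurableSpace V] [BorelSpace V]

/-- ★ **Gaussian–cosine moments of a real positive-definite function are nonnegative.**  For `φ : V → ℝ` continuous, even and
positive definite over `ℝ` (`∑ᵢⱼ cᵢcⱼ φ(zᵢ − zⱼ) ≥ 0`), `∫ φ(x) cos⟪a,x⟫ e^{−‖x‖²/2} dx ≥ 0` for every `a`: the moment is
`(φ 0 + 1) · Re 𝓕[e^{−‖·‖²/2} φ/(φ 0 + 1)](a/2π)`, nonnegative by `IsPositiveDefinite.re_fourier_gauss_mul_nonneg`. [cite: Bochner1933, §3] -/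
theorem integral_mul_cosGauss_nonneg_of_realPosDef (φ : V → ℝ) (hc : Continuous φ)
    (hPD : ∀ (m : ℕ) (z : Fin m → V) (c : Fin m → ℝ), 0 ≤ ∑ i, ∑ j, c i * c j * φ (z i - z j))
    (heven : ∀ z, φ (-z) = φ z) (a : V) :
    0 ≤ ∫ x, φ x * (Real.cos ⟪a, x⟫ * Real.exp (-(‖x‖ ^ 2 / 2))) := by
  -- normalisation
  have h0 : 0 ≤ φ 0 := apply_zero_nonneg_of_realPosDef φ hPD
  set B : ℝ := φ 0 + 1 with hB
  have hBpos : 0 < B := by rw [hB]; linarith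
  have hle : ∀ z, |φ z| ≤ φ 0 := abs_le_apply_zero_of_realPosDef φ hPD heven
  set ψ : V → ℝ := fun z => φ z / B with hψ
  have hψPD : ∀ (m : ℕ) (z : Fin m → V) (c : Fin m → ℝ), 0 ≤ ∑ i, ∑ j, c i * c j * ψ (z i - z j) := by
    intro m z c
    have : ∑ i, ∑ j, c i * c j * ψ (z i - z j) = (∑ i, ∑ j, c i * c j * φ (z i - z j)) / B := by
      rw [Finset.sum_div]
      refine Finset.sum_congr rfl fun i _ => ?_
      rw [Finset.sum_div]
      refine Finset.sum_congr rfl fun j _ => ?_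
      simp only [hψ]
      ring
    rw [this]
    exact div_nonneg (hPD m z c) hBpos.le
  have hψeven : ∀ z, ψ (-z) = ψ z := fun z => by simp only [hψ, heven]
  have hψc : Continuous ψ := hc.div_const B
  have hψb : ∀ z, |ψ z| ≤ 1 := fun z => by
    rw [hψ]; dsimp only
    rw [abs_div, abs_of_pos hBpos, div_le_one hBpos]
    exact (hle z).trans (by rw [hB]; linarith)
  -- the Hermitian positive-definite function `C = ψ : V → ℂ`
  have hC : IsPositiveDefinite (fun z => ((ψ z : ℝ) : ℂ)) := isPositiveDefinite_ofReal_of_realPosDef ψ hψPD hψeven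
  have hCc : Continuous fun z => ((ψ z : ℝ) : ℂ) := Complex.continuous_ofReal.comp hψc
  have hCb : ∀ z, ‖((ψ z : ℝ) : ℂ)‖ ≤ 1 := fun z => by rw [Complex.norm_real, Real.norm_eq_abs]; exact hψb z
  -- Fourier positivity at `w = a / 2π`
  set w : V := (1 / (2 * π)) • a with hw
  have hpos := (hC.re_fourier_gauss_mul_nonneg hCc hCb one_pos w).1
  -- the damped function, in real form
  set r : V → ℝ := fun v => Real.cos (2 * π * ⟪v, w⟫) * ψ v with hr
  set s : V → ℝ := fun v => Real.sin (2 * π * ⟪v, w⟫) * ψ v with hs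
  have hphase : Continuous fun v : V => 2 * π * ⟪v, w⟫ := continuous_const.mul (continuous_id.inner continuous_const)
  have hrc : Continuous r := (Real.continuous_cos.comp hphase).mul hψc
  have hsc : Continuous s := (Real.continuous_sin.comp hphase).mul hψc
  have hrb : ∀ v, |r v| ≤ 1 := fun v => by
    rw [hr]; dsimp only; rw [abs_mul]
    exact mul_le_one₀ (Real.abs_cos_le_one _) (abs_nonneg _) (hψb v)
  have hsb : ∀ v, |s v| ≤ 1 := fun v => by
    rw [hs]; dsimp only; rw [abs_mul]
    exact mul_le_one₀ (Real.abs_sin_le_one _) (abs_nonneg _) (hψb v)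
  have hri : Integrable fun v => r v * Real.exp (-(‖v‖ ^ 2 / 2)) := integrable_mul_gauss hrc hrb
  have hsi : Integrable fun v => s v * Real.exp (-(‖v‖ ^ 2 / 2)) := integrable_mul_gauss hsc hsb
  have hsplit : ∀ v : V, Complex.exp (↑(-2 * π * ⟪v, w⟫) * Complex.I) •
      (((rexp (-(1 / 2) * ‖v‖ ^ 2) : ℝ) : ℂ) * ((ψ v : ℝ) : ℂ)) =
      ((r v * Real.exp (-(‖v‖ ^ 2 / 2)) : ℝ) : ℂ) - Complex.I * ((s v * Real.exp (-(‖v‖ ^ 2 / 2)) : ℝ) : ℂ) := by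
    intro v
    rw [smul_eq_mul, hr, hs]
    dsimp only
    rw [show ((-2 * π * ⟪v, w⟫ : ℝ) : ℂ) * Complex.I = ((-(2 * π * ⟪v, w⟫) : ℝ) : ℂ) * Complex.I by push_cast; ring,
      Complex.exp_mul_I, ← Complex.ofReal_cos, ← Complex.ofReal_sin, Real.cos_neg, Real.sin_neg,
      show (-(1 / 2) * ‖v‖ ^ 2 : ℝ) = -(‖v‖ ^ 2 / 2) by ring]
    push_cast
    ring
  have hF : (𝓕 (fun v : V => ((rexp (-(1 / 2) * ‖v‖ ^ 2) : ℝ) : ℂ) * ((ψ v : ℝ) : ℂ)) w).re =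
      ∫ v, r v * Real.exp (-(‖v‖ ^ 2 / 2)) := by
    rw [Real.fourier_eq']
    simp_rw [hsplit]
    rw [integral_sub hri.ofReal (hsi.ofReal.const_mul _), integral_const_mul, integral_complex_ofReal,
      integral_complex_ofReal]
    simp
  rw [hF] at hpos
  -- read off the moment: `2π⟪v, w⟫ = ⟪a, v⟫` and `r·gauss = (1/B) · φ · cos · gauss`
  have hinner : ∀ v : V, 2 * π * ⟪v, w⟫ = ⟪a, v⟫ := fun v => by
    rw [hw, real_inner_smul_right, real_inner_comm]
    field_simp
  have hrw : ∀ v : V, r v * Real.exp (-(‖v‖ ^ 2 / 2)) = B⁻¹ * (φ v * (Real.cos ⟪a, v⟫ * Real.exp (-(‖v‖ ^ 2 / 2)))) := by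
    intro v
    rw [hr]; dsimp only; rw [hinner v, hψ]; dsimp only
    rw [div_eq_mul_inv]
    ring
  simp_rw [hrw] at hpos
  rw [integral_const_mul] at hpos
  exact (mul_nonneg_iff_of_pos_left (inv_pos.2 hBpos)).1 hpos

end Summit.QuantumFields.YangMills.Theorems.F4SubCurvatureDoorSliceFourier

end
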